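/-
Copyright: rh-split cell (screw, prover seat l19) gen 0, 2026-08-27.  Splitting search over kernel-typed
RH-equivalences; this module is ζ-free analysis.  Nothing here bears on the truth of RH.
-/
import Summits.RiemannHypothesis.RiemannHypothesis.Theorems.Splittings.ScrewBorelFluxB
import HarnessLib

/-!
# No porous access to an inside pole (ζ-free kernel of route X-12 `ScrewPorousWall`, item `NoPorousPole`)

Data as in `ScrewBorelContinuationA`: an index type `ι`, coefficients `c : ι → ℂ` with `∑ ‖c i‖ < ∞` and
`Re (c i) < 0`, non-zero multipliers `u : ι → ℂ`, the Borel series `B(z) = ∑' i, term (c i) (u i) z`, and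
its INSIDE POLE SET `poleSet u = {p : ‖p‖ < 1, p = u i ∨ p = (u i)⁻¹}`.

A point `z` is `κ`-POROUS with respect to the inside pole `p` (`κ > 0`) if every OTHER inside pole `q ≠ p`
satisfies `κ‖z - p‖ ≤ ‖q - z‖` — the other poles stay outside the disc of radius `κ‖z - p‖` about `z`
(a porosity corridor at `p`, Zajíček's lower porosity localised at one point).

**Theorem** (`le_norm_sub_of_porous`; sequence form `false_of_porous_access`).  Let `F` be
complex-differentiable on the open unit disc and equal to `B` on a pole-free disc `ball 0 r₀`; let `V ∋ 0`
be a preconnected subset of `𝔻 ∖ closure (poleSet u)` and `p` an inside pole.  For every `κ > 0` there is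
`θ > 0` such that every `κ`-porous point `z ∈ V` satisfies `θ ≤ ‖z - p‖`.  In particular no sequence of
`κ`-porous points of `V` converges to `p`.

Proof.  On `V`, `F = B` (`ScrewBorelFlux.eqOn_of_preconnected`).  Split
`B(z) = C_p (1 - z/p)⁻¹ + R_p(z)` (`term_eq_poleCoeff_add_regTerm`) with `Re C_p < 0`
(`re_tsum_poleCoeff_neg`).  Choose a FINITE set `T` of indices carrying all but `κ‖C_p‖‖p‖/4` of the
mass `S = ∑ ‖c i‖` (`exists_finset_tsum_ite_lt`) and `η > 0` below the distance from `p` to every other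
pole of an index in `T`.  At a porous point `z` near `p` the regular terms of indices in `T` are bounded by
`2‖c i‖/δ₀` (`δ₀ = min (1 - r) (η/2)`, `r = (‖p‖ + 1)/2`), all others by `2‖c i‖/(κ‖z - p‖)` (porosity
keeps their poles `κ‖z - p‖`-away from `z`), whence `‖R_p(z)‖ ≤ 2S/δ₀ + ‖C_p‖‖p‖/(2‖z - p‖)`
(`norm_tsum_regTerm_le_of_porous`) and `‖F z‖ ≥ ‖C_p‖‖p‖/(2‖z - p‖) - 2S/δ₀`, against the continuity of
`F` at `p ∈ 𝔻`.

The walls theorem `ScrewBorel.not_mem_closure_of_isolated` is the special case of an ISOLATED pole (every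
point near an isolated pole is `1`-porous): `not_mem_closure_of_isolated_of_porous`.

No `sorry`, no new axioms, no instances, no notation.
-/

set_option linter.dupNamespace false

namespace Summit.RiemannHypothesis.RiemannHypothesis.Theorems.Splittings.ScrewBorelPorous

open Complex Filter Topology Set Metric
open Summit.RiemannHypothesis.RiemannHypothesis.Theorems.Splittings.ScrewBorel
open Summit.RiemannHypothesis.RiemannHypothesis.Theorems.Splittings.ScrewBorelFlux

/-! ## 1. Bookkeeping: a positive lower bound on a finite set, an ℓ¹ tail -/

/-- A positive function has a uniform positive lower bound on a finite set. -/
theorem exists_pos_le_on_finset {ι : Type*} [DecidableEq ι] (T : Finset ι) {g : ι → ℝ}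
    (hg : ∀ i, 0 < g i) : ∃ η : ℝ, 0 < η ∧ ∀ i ∈ T, η ≤ g i := by
  induction T using Finset.induction_on with
  | empty => exact ⟨1, one_pos, fun i hi ↦ absurd hi (by simp)⟩
  | insert a s _ ih =>
    obtain ⟨η, hη, h⟩ := ih
    refine ⟨min η (g a), lt_min hη (hg a), fun i hi ↦ ?_⟩
    rcases Finset.mem_insert.1 hi with rfl | hi
    · exact min_le_right _ _
    · exact (min_le_left _ _).trans (h i hi)

/-- **ℓ¹ tail.**  For a summable real family and `ε > 0` some finite set `T` of indices carries all but
`ε` of the sum: `∑' i, (if i ∈ T then 0 else f i) < ε`. -/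
theorem exists_finset_tsum_ite_lt {ι : Type*} [DecidableEq ι] {f : ι → ℝ} (hf : Summable f)
    {ε : ℝ} (hε : 0 < ε) :
    ∃ T : Finset ι, (Summable fun i ↦ if i ∈ T then (0 : ℝ) else f i) ∧
      ∑' i, (if i ∈ T then (0 : ℝ) else f i) < ε := by
  have hT : Tendsto (fun s : Finset ι ↦ ∑ i ∈ s, f i) atTop (𝓝 (∑' i, f i)) := hf.hasSum
  obtain ⟨T, hTε⟩ := Metric.tendsto_atTop.1 hT ε hε
  have hd := hTε T le_rfl
  rw [Real.dist_eq] at hd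
  -- the finitely supported part
  set s : ι → ℝ := fun i ↦ if i ∈ T then f i else 0 with hs
  have hs0 : ∀ i ∉ T, s i = 0 := fun i hi ↦ by simp [hs, hi]
  have hssum : Summable s := summable_of_ne_finset_zero hs0
  have hstsum : ∑' i, s i = ∑ i ∈ T, f i := by
    rw [tsum_eq_sum hs0]
    exact Finset.sum_congr rfl fun i hi ↦ by simp [hs, hi]
  have heq : (fun i ↦ if i ∈ T then (0 : ℝ) else f i) = fun i ↦ f i - s i := by
    funext i
    by_cases hi : i ∈ T <;> simp [hs, hi]
  refine ⟨T, ?_, ?_⟩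
  · rw [heq]; exact hf.sub hssum
  · rw [heq, hf.tsum_sub hssum, hstsum]
    have := (abs_sub_lt_iff.1 hd).2
    linarith

/-! ## 2. The regular part of the Borel series at a porous point -/

/-- **Regular part at a porous point.**  Fix a finite index set `T`, a real `η` not exceeding the distance
from `p` to every pole `≠ p` of an index in `T`, and put `r = (‖p‖ + 1)/2`, `δ₀ = min (1 - r) (η/2)`.  At a
point `z` with `0 < ‖z - p‖ ≤ min ((1 - ‖p‖)/2) (η/2)` and `κ‖z - p‖ ≤ δ₀` which is `κ`-porous with respect
to `p`, the regular part `∑' regTerm` is summable and bounded by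
`2(∑ ‖c i‖)/δ₀ + 2(∑_{i ∉ T} ‖c i‖)/(κ‖z - p‖)`. -/
theorem norm_tsum_regTerm_le_of_porous {ι : Type*} [DecidableEq ι] {c u : ι → ℂ}
    (hc : Summable fun i ↦ ‖c i‖) (hu : ∀ i, u i ≠ 0) {p : ℂ} (T : Finset ι) {η : ℝ}
    (hT : ∀ i ∈ T, (u i ≠ p → η ≤ ‖u i - p‖) ∧ ((u i)⁻¹ ≠ p → η ≤ ‖(u i)⁻¹ - p‖))
    {κ : ℝ} (hκ : 0 < κ) {z : ℂ} (hz0 : 0 < ‖z - p‖) (hz1 : ‖z - p‖ ≤ (1 - ‖p‖) / 2)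
    (hz2 : ‖z - p‖ ≤ η / 2) (hz3 : κ * ‖z - p‖ ≤ min (1 - (‖p‖ + 1) / 2) (η / 2))
    (hpor : ∀ q ∈ poleSet u, q ≠ p → κ * ‖z - p‖ ≤ ‖q - z‖) :
    (Summable fun i ↦ regTerm (c i) (u i) p z) ∧
      ‖∑' i, regTerm (c i) (u i) p z‖ ≤
        2 * (∑' i, ‖c i‖) / min (1 - (‖p‖ + 1) / 2) (η / 2) +
          2 * (∑' i, if i ∈ T then (0 : ℝ) else ‖c i‖) / (κ * ‖z - p‖) := by
  set r : ℝ := (‖p‖ + 1) / 2 with hr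
  set δ₀ : ℝ := min (1 - r) (η / 2) with hδ₀
  have hδ₀pos : 0 < δ₀ := lt_min (by rw [hr]; linarith) (by linarith)
  have hδ₀r : δ₀ ≤ 1 - r := min_le_left _ _
  have hδ₀η : δ₀ ≤ η / 2 := min_le_right _ _
  have hzr : ‖z‖ ≤ r := by
    have e : p + (z - p) = z := by ring
    have := norm_add_le p (z - p)
    rw [e] at this
    rw [hr]; linarith
  have hκz : 0 < κ * ‖z - p‖ := mul_pos hκ hz0
  set t : ι → ℝ := fun i ↦ if i ∈ T then (0 : ℝ) else ‖c i‖ with ht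
  have ht0 : ∀ i, 0 ≤ t i := fun i ↦ by
    by_cases hi : i ∈ T <;> simp [ht, hi]
  have htle : ∀ i, t i ≤ ‖c i‖ := fun i ↦ by
    by_cases hi : i ∈ T <;> simp [ht, hi]
  have htsum : Summable t := Summable.of_nonneg_of_le ht0 htle hc
  -- per-term bound
  have hbound : ∀ i, ‖regTerm (c i) (u i) p z‖ ≤ 2 * ‖c i‖ / δ₀ + 2 * t i / (κ * ‖z - p‖) := by
    intro i
    by_cases hi : i ∈ T
    · -- an index of `T`: its other poles are `η`-far from `p`, hence `δ₀`-far from `z`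
      have h1 : ‖regTerm (c i) (u i) p z‖ ≤ 2 * ‖c i‖ / δ₀ := by
        refine norm_regTerm_le (hu i) hδ₀pos hδ₀r hzr (fun hne _ ↦ ?_) (fun hne _ ↦ ?_)
        · have hq := (hT i hi).2 hne
          have e : ((u i)⁻¹ - z) + (z - p) = (u i)⁻¹ - p := by ring
          have := norm_add_le ((u i)⁻¹ - z) (z - p)
          rw [e] at this
          linarith
        · have hq := (hT i hi).1 hne
          have e : (u i - z) + (z - p) = u i - p := by ring
          have := norm_add_le (u i - z) (z - p)
          rw [e] at this
          linarith
      have h2 : t i = 0 := by simp [ht, hi]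
      rw [h2, mul_zero, zero_div, add_zero]
      exact h1
    · -- any other index: porosity keeps its poles `κ‖z - p‖`-far from `z`
      have h1 : ‖regTerm (c i) (u i) p z‖ ≤ 2 * ‖c i‖ / (κ * ‖z - p‖) := by
        refine norm_regTerm_le (hu i) hκz (hz3.trans hδ₀r) hzr (fun hne hlt ↦ ?_)
          (fun hne hlt ↦ ?_)
        · exact hpor _ ⟨hlt, i, Or.inr rfl⟩ hne
        · exact hpor _ ⟨hlt, i, Or.inl rfl⟩ hne
      have h2 : t i = ‖c i‖ := by simp [ht, hi]
      have h3 : 0 ≤ 2 * ‖c i‖ / δ₀ := by positivity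
      rw [h2]
      linarith
  have hbsum : Summable fun i ↦ 2 * ‖c i‖ / δ₀ + 2 * t i / (κ * ‖z - p‖) :=
    ((hc.mul_left 2).div_const δ₀).add ((htsum.mul_left 2).div_const _)
  have hsn : Summable fun i ↦ ‖regTerm (c i) (u i) p z‖ :=
    Summable.of_nonneg_of_le (fun i ↦ norm_nonneg _) hbound hbsum
  refine ⟨hsn.of_norm, (norm_tsum_le_tsum_norm hsn).trans ?_⟩
  calc ∑' i, ‖regTerm (c i) (u i) p z‖
      ≤ ∑' i, (2 * ‖c i‖ / δ₀ + 2 * t i / (κ * ‖z - p‖)) := hsn.tsum_le_tsum hbound hbsum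
    _ = 2 * (∑' i, ‖c i‖) / δ₀ + 2 * (∑' i, t i) / (κ * ‖z - p‖) := by
        rw [((hc.mul_left 2).div_const δ₀).tsum_add ((htsum.mul_left 2).div_const _),
          tsum_div_const, tsum_mul_left, tsum_div_const, tsum_mul_left]

/-! ## 3. Porous points of `V` stay away from every inside pole -/

/-- **No porous access to an inside pole (quantitative, ζ-free).**  `c` absolutely summable with
`Re (c i) < 0`, `u i ≠ 0`; `F` complex-differentiable on the unit disc and equal to the Borel series on a
disc `ball 0 r₀` (`r₀ > 0`); `V ∋ 0` a preconnected subset of `ball 0 1 ∖ closure (poleSet u)`; `p` an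
inside pole; `κ > 0`.  Then there is `θ > 0` such that every point `z ∈ V` at which the other inside poles
are `κ`-porous (`κ‖z - p‖ ≤ ‖q - z‖` for all `q ∈ poleSet u`, `q ≠ p`) satisfies `θ ≤ ‖z - p‖`. -/
theorem le_norm_sub_of_porous {ι : Type*} {c u : ι → ℂ} (hc : Summable fun i ↦ ‖c i‖)
    (hre : ∀ i, (c i).re < 0) (hu : ∀ i, u i ≠ 0) {F : ℂ → ℂ} (hF : DifferentiableOn ℂ F (ball 0 1))
    {r₀ : ℝ} (hr₀ : 0 < r₀) (hFB : EqOn F (fun z ↦ ∑' i, term (c i) (u i) z) (ball 0 r₀))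
    {V : Set ℂ} (hV : IsPreconnected V) (hV0 : (0 : ℂ) ∈ V)
    (hVsub : V ⊆ ball 0 1 \ closure (poleSet u))
    {p : ℂ} (hp : p ∈ poleSet u) {κ : ℝ} (hκ : 0 < κ) :
    ∃ θ : ℝ, 0 < θ ∧ ∀ z ∈ V,
      (∀ q ∈ poleSet u, q ≠ p → κ * ‖z - p‖ ≤ ‖q - z‖) → θ ≤ ‖z - p‖ := by
  classical
  have hp1 : ‖p‖ < 1 := hp.1
  have hp0 : p ≠ 0 := by
    obtain ⟨i, hi | hi⟩ := hp.2
    · rw [hi]; exact hu i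
    · rw [hi]; exact inv_ne_zero (hu i)
  have hpn : 0 < ‖p‖ := norm_pos_iff.2 hp0
  -- `F = B` on `V`
  have hFBV := eqOn_of_preconnected hc hu hF hr₀ hFB hV hV0 hVsub
  -- the fibre charge `C` at `p` has negative real part
  have hpc : Summable fun i ↦ poleCoeff (c i) (u i) p :=
    Summable.of_norm_bounded hc (fun i ↦ norm_poleCoeff_le _ _ _)
  set C : ℂ := ∑' i, poleCoeff (c i) (u i) p with hC
  have hCre : C.re < 0 := re_tsum_poleCoeff_neg hc hre hp
  have hC0 : 0 < ‖C‖ := by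
    refine norm_pos_iff.2 fun h ↦ ?_
    rw [h, Complex.zero_re] at hCre
    exact lt_irrefl _ hCre
  have hCp : 0 < ‖C‖ * ‖p‖ := mul_pos hC0 hpn
  -- a finite set `T` of indices carries all but `κ‖C‖‖p‖/4` of the mass
  have hε₁ : 0 < κ * (‖C‖ * ‖p‖) / 4 := div_pos (mul_pos hκ hCp) (by norm_num)
  obtain ⟨T, -, htail⟩ := exists_finset_tsum_ite_lt hc hε₁
  -- `η > 0` below the distance from `p` to every other pole of an index in `T`
  set g : ι → ℝ := fun i ↦ min (if u i = p then 1 else ‖u i - p‖)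
    (if (u i)⁻¹ = p then 1 else ‖(u i)⁻¹ - p‖) with hg
  have hgpos : ∀ i, 0 < g i := by
    intro i
    refine lt_min ?_ ?_
    · split_ifs with h
      · exact one_pos
      · exact norm_pos_iff.2 (sub_ne_zero.2 h)
    · split_ifs with h
      · exact one_pos
      · exact norm_pos_iff.2 (sub_ne_zero.2 h)
  obtain ⟨η, hη, hηT⟩ := exists_pos_le_on_finset T hgpos
  have hT : ∀ i ∈ T, (u i ≠ p → η ≤ ‖u i - p‖) ∧ ((u i)⁻¹ ≠ p → η ≤ ‖(u i)⁻¹ - p‖) := by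
    intro i hi
    have h := hηT i hi
    refine ⟨fun hne ↦ h.trans ?_, fun hne ↦ h.trans ?_⟩
    · show min (if u i = p then (1 : ℝ) else ‖u i - p‖)
        (if (u i)⁻¹ = p then (1 : ℝ) else ‖(u i)⁻¹ - p‖) ≤ ‖u i - p‖
      rw [if_neg hne]
      exact min_le_left _ _
    · show min (if u i = p then (1 : ℝ) else ‖u i - p‖)
        (if (u i)⁻¹ = p then (1 : ℝ) else ‖(u i)⁻¹ - p‖) ≤ ‖(u i)⁻¹ - p‖
      rw [if_neg hne]
      exact min_le_right _ _
  -- constants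
  set δ₀ : ℝ := min (1 - (‖p‖ + 1) / 2) (η / 2) with hδ₀
  have hδ₀pos : 0 < δ₀ := lt_min (by linarith) (by linarith)
  set S : ℝ := ∑' i, ‖c i‖ with hS
  have hS0 : 0 ≤ S := tsum_nonneg fun i ↦ norm_nonneg (c i)
  set M : ℝ := 2 * S / δ₀ with hM
  have hM0 : 0 ≤ M := by rw [hM]; positivity
  have hFcont : ContinuousAt F p :=
    hF.continuousOn.continuousAt (isOpen_ball.mem_nhds (mem_ball_zero_iff.2 hp1))
  obtain ⟨ρ, hρ, hFρ⟩ := Metric.continuousAt_iff.1 hFcont 1 one_pos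
  set L : ℝ := ‖F p‖ + 1 + M with hL
  have hL0 : 0 < L := by rw [hL]; have := norm_nonneg (F p); linarith
  set θ : ℝ := min (min (min ((1 - ‖p‖) / 2) (η / 2)) (min (δ₀ / κ) ρ)) (‖C‖ * ‖p‖ / (2 * L))
    with hθ
  have hθpos : 0 < θ :=
    lt_min (lt_min (lt_min (by linarith) (by linarith)) (lt_min (div_pos hδ₀pos hκ) hρ))
      (div_pos hCp (by linarith))
  refine ⟨θ, hθpos, fun z hzV hpor ↦ ?_⟩
  by_contra hlt
  push Not at hlt
  have hz1 : ‖z - p‖ ≤ (1 - ‖p‖) / 2 :=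
    (hlt.trans_le ((min_le_left _ _).trans ((min_le_left _ _).trans (min_le_left _ _)))).le
  have hz2 : ‖z - p‖ ≤ η / 2 :=
    (hlt.trans_le ((min_le_left _ _).trans ((min_le_left _ _).trans (min_le_right _ _)))).le
  have hz3 : κ * ‖z - p‖ ≤ δ₀ := by
    have h : ‖z - p‖ < δ₀ / κ :=
      hlt.trans_le ((min_le_left _ _).trans ((min_le_right _ _).trans (min_le_left _ _)))
    rw [lt_div_iff₀ hκ] at h
    linarith
  have hzρ : dist z p < ρ := by
    rw [dist_eq_norm]
    exact hlt.trans_le ((min_le_left _ _).trans ((min_le_right _ _).trans (min_le_right _ _)))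
  have hzC : ‖z - p‖ < ‖C‖ * ‖p‖ / (2 * L) := hlt.trans_le (min_le_right _ _)
  -- `z ≠ p`
  have hzne : z - p ≠ 0 := by
    intro h
    have hzp' : z = p := sub_eq_zero.1 h
    exact (hVsub hzV).2 (hzp' ▸ subset_closure hp)
  have hzn : 0 < ‖z - p‖ := norm_pos_iff.2 hzne
  -- the regular part at `z`
  obtain ⟨hrs, hrb⟩ :=
    norm_tsum_regTerm_le_of_porous hc hu T hT hκ hzn hz1 hz2 hz3 hpor
  have htail' : 2 * (∑' i, if i ∈ T then (0 : ℝ) else ‖c i‖) / (κ * ‖z - p‖) ≤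
      ‖C‖ * ‖p‖ / (2 * ‖z - p‖) := by
    rw [div_le_div_iff₀ (mul_pos hκ hzn) (by positivity)]
    have h4 := mul_le_mul_of_nonneg_right htail.le hzn.le
    nlinarith
  have hRle : ‖∑' i, regTerm (c i) (u i) p z‖ ≤ M + ‖C‖ * ‖p‖ / (2 * ‖z - p‖) := by
    rw [hM]; linarith
  -- decomposition of the Borel series at `z`
  have hsplit : ∑' i, term (c i) (u i) z = C * (1 - z / p)⁻¹ + ∑' i, regTerm (c i) (u i) p z := by
    have h1 : ∀ i, term (c i) (u i) z =
        poleCoeff (c i) (u i) p * (1 - z / p)⁻¹ + regTerm (c i) (u i) p z :=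
      fun i ↦ term_eq_poleCoeff_add_regTerm (c i) (u i) p z
    simp_rw [h1]
    rw [(hpc.mul_right _).tsum_add hrs, tsum_mul_right]
  have hpolar : ‖C * (1 - z / p)⁻¹‖ = ‖C‖ * ‖p‖ / ‖z - p‖ := by
    have e : (1 - z / p)⁻¹ = p / (p - z) := by
      rw [one_sub_div hp0, inv_div]
    rw [e, norm_mul, norm_div, norm_sub_rev]
    ring
  -- `‖F z‖ ≤ ‖F p‖ + 1`
  have hFb : ‖F z‖ ≤ ‖F p‖ + 1 := by
    have h := hFρ hzρ
    rw [dist_eq_norm] at h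
    have e : F p + (F z - F p) = F z := by ring
    have := norm_add_le (F p) (F z - F p)
    rw [e] at this
    linarith
  -- `‖F z‖ ≥ ‖C‖‖p‖/‖z - p‖ - ‖R(z)‖ ≥ ‖C‖‖p‖/(2‖z - p‖) - M`
  have hFz : F z = ∑' i, term (c i) (u i) z := hFBV hzV
  have hlow : ‖C‖ * ‖p‖ / ‖z - p‖ - (M + ‖C‖ * ‖p‖ / (2 * ‖z - p‖)) ≤ ‖F z‖ := by
    rw [hFz, hsplit]
    have h1 := norm_sub_le (C * (1 - z / p)⁻¹ + ∑' i, regTerm (c i) (u i) p z)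
      (∑' i, regTerm (c i) (u i) p z)
    rw [add_sub_cancel_right, hpolar] at h1
    linarith
  have hhalf : ‖C‖ * ‖p‖ / ‖z - p‖ = 2 * (‖C‖ * ‖p‖ / (2 * ‖z - p‖)) := by
    field_simp
  have hbig : L < ‖C‖ * ‖p‖ / (2 * ‖z - p‖) := by
    rw [lt_div_iff₀ (by positivity)]
    have := (lt_div_iff₀ (by positivity : (0 : ℝ) < 2 * L)).1 hzC
    linarith
  rw [hL] at hbig
  rw [hhalf] at hlow
  linarith

/-- **No porous access to an inside pole (sequence form, ζ-free).**  Under the hypotheses of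
`le_norm_sub_of_porous`: no sequence `z_n → p` of points of `V` with `κ‖z_n - p‖ ≤ ‖q - z_n‖` for all
`n` and all inside poles `q ≠ p` exists. -/
theorem false_of_porous_access {ι : Type*} {c u : ι → ℂ} (hc : Summable fun i ↦ ‖c i‖)
    (hre : ∀ i, (c i).re < 0) (hu : ∀ i, u i ≠ 0) {F : ℂ → ℂ} (hF : DifferentiableOn ℂ F (ball 0 1))
    {r₀ : ℝ} (hr₀ : 0 < r₀) (hFB : EqOn F (fun z ↦ ∑' i, term (c i) (u i) z) (ball 0 r₀))
    {V : Set ℂ} (hV : IsPreconnected V) (hV0 : (0 : ℂ) ∈ V)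
    (hVsub : V ⊆ ball 0 1 \ closure (poleSet u))
    {p : ℂ} (hp : p ∈ poleSet u) {κ : ℝ} (hκ : 0 < κ) {z : ℕ → ℂ} (hz : Tendsto z atTop (𝓝 p))
    (hzV : ∀ n, z n ∈ V) (hpor : ∀ n, ∀ q ∈ poleSet u, q ≠ p → κ * ‖z n - p‖ ≤ ‖q - z n‖) :
    False := by
  obtain ⟨θ, hθ, hfar⟩ := le_norm_sub_of_porous hc hre hu hF hr₀ hFB hV hV0 hVsub hp hκ
  obtain ⟨N, hN⟩ := Metric.tendsto_atTop.1 hz θ hθ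
  have h1 := hN N le_rfl
  rw [dist_eq_norm] at h1
  exact absurd (hfar (z N) (hzV N) (hpor N)) (not_le.2 h1)

/-- **The walls theorem recovered.**  An inside pole `p` isolated within `2ε` in `closure (poleSet u)`
(`‖p‖ + 2ε < 1`) makes every point `z` with `‖z - p‖ < ε` `1`-porous, so `p ∉ closure V`: the statement
of `ScrewBorel.not_mem_closure_of_isolated`, re-derived from `le_norm_sub_of_porous`. -/
theorem not_mem_closure_of_isolated_of_porous {ι : Type*} {c u : ι → ℂ}
    (hc : Summable fun i ↦ ‖c i‖) (hre : ∀ i, (c i).re < 0) (hu : ∀ i, u i ≠ 0) {F : ℂ → ℂ}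
    (hF : DifferentiableOn ℂ F (ball 0 1)) {r₀ : ℝ} (hr₀ : 0 < r₀)
    (hFB : EqOn F (fun z ↦ ∑' i, term (c i) (u i) z) (ball 0 r₀))
    {V : Set ℂ} (hV : IsPreconnected V) (hV0 : (0 : ℂ) ∈ V)
    (hVsub : V ⊆ ball 0 1 \ closure (poleSet u))
    {p : ℂ} (hp : p ∈ poleSet u) {ε : ℝ} (hε : 0 < ε)
    (hiso : ∀ q ∈ closure (poleSet u), ‖q - p‖ < 2 * ε → q = p) : p ∉ closure V := by
  intro hpV
  obtain ⟨θ, hθ, hfar⟩ := le_norm_sub_of_porous hc hre hu hF hr₀ hFB hV hV0 hVsub hp one_pos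
  obtain ⟨z, hzV, hzd⟩ := Metric.mem_closure_iff.1 hpV (min θ ε) (lt_min hθ hε)
  rw [dist_comm, dist_eq_norm] at hzd
  have hzθ : ‖z - p‖ < θ := hzd.trans_le (min_le_left _ _)
  have hzε : ‖z - p‖ < ε := hzd.trans_le (min_le_right _ _)
  refine absurd (hfar z hzV fun q hq hqp ↦ ?_) (not_le.2 hzθ)
  have hqfar : ¬ ‖q - p‖ < 2 * ε := fun h ↦ hqp (hiso q (subset_closure hq) h)
  push Not at hqfar
  have e : (q - z) + (z - p) = q - p := by ring
  have := norm_add_le (q - z) (z - p)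
  rw [e] at this
  rw [one_mul]
  linarith

end Summit.RiemannHypothesis.RiemannHypothesis.Theorems.Splittings.ScrewBorelPorous
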